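import Summits.AnomalousDissipation.AnomalousDissipation.Theorems.WazewskiBlockUniformGalerkinTrapLandingEquivalence
import Summits.AnomalousDissipation.AnomalousDissipation.Theorems.MomentParityResolvedDissipationStubZeroMeanGalerkinFlow
import Summits.AnomalousDissipation.AnomalousDissipation.Theorems.CubicParityLoud.Negative.Clauses
import Literature.Analysis.FluidPDE.NSGalerkinFamilyLimit
import HarnessLib

/-!
# Stub `stub_restart` for line `enstrophy-ui-transfer` (crux `MomentParity.ResolvedDissipation`)

Supports stmt-AnomalousDissipation-14284 (stub stub_restart for line enstrophy-ui-transfer, lead c7).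
Nothing here closes an item.

Sorry-free discharge of the registered stub `stub_restart` (S12) of the lead's skeleton v8:
members of a Hopf–Galerkin family `U` of the forced Navier–Stokes equations on `T³` with the EXACT
steady force `F n = f` restart as Galerkin orbits. At index `n` the clauses of
`IsHopfGalerkinFamily` are verbatim those of `Torus.IsGalerkinTrajectory ν f (N n) (U n)`, so
uniqueness for the Galerkin ODE (`UniformGalerkinTrap.apply_add_eq_galerkinFlow_of_isGalerkinTrajectory`)
gives `U n (τ + s) = S^{N n}_τ (U n s)`; in particular `U n s = S_s (U n 0)` has zero mean when the
datum has (`ZeroMeanFlow.stub_zeroMean_galerkinFlow`); and set-`lintegral`s over the shifted window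
`(s, s + T)` are set-`lintegral`s over `(0, T)` along the orbit (translation invariance of Lebesgue
measure, `MeasurePreserving.setLIntegral_comp_emb`).

References: Constantin–Foias, *Navier–Stokes Equations* (Chicago 1988), Ch. 8, (8.5)–(8.6);
Robinson–Rodrigo–Sadowski, *The three-dimensional Navier–Stokes equations* (CUP 2016), §4.1, Thm 4.4.
-/

noncomputable section

set_option linter.dupNamespace false

namespace Summit.AnomalousDissipation.AnomalousDissipation.Theorems.MomentParityResolvedDissipation.Restart

open MeasureTheory Filter Topology Set UnitAddTorus
open scoped ENNReal InnerProductSpace RealInnerProductSpace BigOperators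
open Literature.Analysis.FunctionSpaces Literature.Analysis.FunctionSpaces.Torus
open Literature.Analysis.FluidPDE Literature.Analysis.FluidPDE.Torus
open Summit.AnomalousDissipation.AnomalousDissipation.Theorems.CubicParityLoud.Negative (T3 R3)

/-- Every member of a Hopf–Galerkin family whose approximate forces are the steady force itself,
`F n t = f`, is a Galerkin trajectory of order `N n` with force `f` (projection of the per-index
clauses; compare `IsHopfGalerkinScheme.isGalerkinTrajectory`). [folklore] -/
theorem isGalerkinTrajectory_of_isHopfGalerkinFamily {ν : ℝ} {f u₀ : T3 → R3} {N : ℕ → ℕ}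
    {U : ℕ → ℝ → T3 → R3} (hF : IsHopfGalerkinFamily ν (fun _ => f) u₀ N (fun _ _ => f) U) (n : ℕ) :
    Torus.IsGalerkinTrajectory ν f (N n) (U n) where
  continuousOn := hF.continuousOn n
  isGalerkinMode := hF.isGalerkinMode n
  isWeaklyDivFree := hF.isWeaklyDivFree n
  galerkin := hF.galerkin n
  energy_eq := hF.energy_eq n

/-- **Translation of set-`lintegral`s along a Galerkin trajectory.** For a Galerkin trajectory `U`
of order `N` with steady force `f ∈ L²`, every `s ≥ 0`, every real `T` and every functional
`G : (T³ → ℝ³) → [0, ∞]`: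
`∫⁻_{(s, s+T)} G (U t) dt = ∫⁻_{(0, T)} G (S_τ (U s)) dτ` — translation invariance of Lebesgue
measure (`MeasurePreserving.setLIntegral_comp_emb` for `τ ↦ τ + s`) and the orbit identity
`U (τ + s) = S_τ (U s)` for `τ ≥ 0`. [folklore] -/
theorem setLIntegral_Ioo_shift_eq_galerkinFlow {ν : ℝ} {f : T3 → R3} {N : ℕ} {U : ℝ → T3 → R3}
    (h : Torus.IsGalerkinTrajectory ν f N U) (hf : MemLp f 2 volume) {s : ℝ} (hs : 0 ≤ s) (T : ℝ)
    (G : (T3 → R3) → ℝ≥0∞) :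
    ∫⁻ t in Set.Ioo s (s + T), G (U t) = ∫⁻ τ in Set.Ioo 0 T, G (Torus.galerkinFlow ν f N τ (U s)) := by
  have hl := (measurePreserving_add_right (volume : Measure ℝ) s).setLIntegral_comp_emb
    (measurableEmbedding_addRight s) (fun t => G (U t)) (Ioo 0 T)
  rw [image_add_const_Ioo, zero_add, add_comm T s] at hl
  rw [← hl]
  refine setLIntegral_congr_fun measurableSet_Ioo fun τ hτ => ?_
  show G (U (τ + s)) = G (Torus.galerkinFlow ν f N τ (U s))
  rw [UniformGalerkinTrap.apply_add_eq_galerkinFlow_of_isGalerkinTrajectory h hf hτ.1.le hs]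

/-- **S12 · `stub_restart` — members of a Hopf–Galerkin family with the exact steady force restart
as Galerkin orbits.** For `ν > 0`, a smooth mean-zero force `f` and a Hopf–Galerkin family `U` with
force `F n = f` and mean-zero data, every slice `U n s` (`s ≥ 0`) is a mean-zero Galerkin mode of
order `N n`, the member IS the Galerkin orbit of that slice, `U n (τ + s) = S^{N n}_τ (U n s)` for
`τ ≥ 0`, and set-`lintegral`s over the shifted window are `lintegral`s along the orbit. Proof: the
clauses of `IsHopfGalerkinFamily` at index `n` with `F n = f` are verbatim those of
`Torus.IsGalerkinTrajectory ν f (N n) (U n)`, so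
`UniformGalerkinTrap.apply_add_eq_galerkinFlow_of_isGalerkinTrajectory` (uniqueness for the Galerkin
ODE) gives the orbit identity, in particular `U n s = S_s (U n 0)`, whence zero mean
(`ZeroMeanFlow.stub_zeroMean_galerkinFlow`); the last clause is translation invariance of Lebesgue
measure. [folklore; Constantin–Foias 1988, Ch. 8 (8.5)–(8.6); Robinson–Rodrigo–Sadowski 2016, §4.1] -/
theorem stub_restart (ν : ℝ) (hν : 0 < ν) (f : T3 → R3) (hf : Torus.IsSmooth f) (hf0 : Torus.HasZeroMean f)
    (u₀ : T3 → R3) (N : ℕ → ℕ) (U : ℕ → ℝ → T3 → R3)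
    (hF : IsHopfGalerkinFamily ν (fun _ => f) u₀ N (fun _ _ => f) U) (hmean : ∀ n, Torus.HasZeroMean (U n 0))
    (n : ℕ) (s : ℝ) (hs : 0 ≤ s) :
    IsGalerkinMode (N n) (U n s) ∧ Torus.HasZeroMean (U n s) ∧
      (∀ τ, 0 ≤ τ → U n (τ + s) = Torus.galerkinFlow ν f (N n) τ (U n s)) ∧
      ∀ (T : ℝ) (G : (T3 → R3) → ℝ≥0∞),
        ∫⁻ t in Set.Ioo s (s + T), G (U n t) = ∫⁻ τ in Set.Ioo 0 T, G (Torus.galerkinFlow ν f (N n) τ (U n s)) := by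
  have htraj : Torus.IsGalerkinTrajectory ν f (N n) (U n) := isGalerkinTrajectory_of_isHopfGalerkinFamily hF n
  have hf2 : MemLp f 2 volume := hf.memLp 2
  refine ⟨hF.isGalerkinMode n s hs, ?_, fun τ hτ => ?_, fun T G => ?_⟩
  · rw [UniformGalerkinTrap.eq_galerkinFlow_of_isGalerkinTrajectory htraj hf2 hs]
    exact ZeroMeanFlow.stub_zeroMean_galerkinFlow ν hν.le f hf hf0 (N n) (U n 0)
      (hF.isGalerkinMode n 0 le_rfl) (hmean n) s hs
  · exact UniformGalerkinTrap.apply_add_eq_galerkinFlow_of_isGalerkinTrajectory htraj hf2 hτ hs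
  · exact setLIntegral_Ioo_shift_eq_galerkinFlow htraj hf2 hs T G

end Summit.AnomalousDissipation.AnomalousDissipation.Theorems.MomentParityResolvedDissipation.Restart

end
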